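import Literature.IUT.HodgeArakelov.AbsTopMonoidsGenuineOfSettingIsm
import Literature.IUT.HodgeArakelov.AbsTopMonoidsGenuineIsometriesOfSetting
import Literature.AnabelianGeometry.EtaleTheta.Discharge.Sec2AugOpenOfSetting
import Literature.AnabelianGeometry.EtaleTheta.SettingModelChiThetaTopology
import Literature.AnabelianGeometry.SemiGraphs.TemperedOpenMapping
import Literature.AnabelianGeometry.SemiGraphs.TemperedCurveBridge
import HarnessLib

/-!
# «`Π^tp_X → G_K` is open» at the [EtTh] theta setting is a THEOREM of «`Π^tp_X` tempered, Galois-countable»: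
# the (H2) binder of the genuine-setting `AbsTopMonoids` producers discharged from the [SemiAnbd] §6 parameters

S. Mochizuki, *Inter-universal Teichmüller theory II*, §1, Example 1.8 (i)–(iv) (kurims pp. 35–39)
[claim: Mochizuki2012, status: disputed]; S. Mochizuki, *Semi-graphs of anabelioids*, Publ. RIMS **42** (2006),
Def. 3.1 (i) p. 33 («tempered»), Example 3.10 p. 43 («natural exact sequence
`1 → π₁^temp(X_K̄) → π₁^temp(X_K) → G_K → 1`») [cite: MochizukiSemiAnbd2006, Ex 3.10 p.43]; S. Mochizuki, *The étale
theta function …*, Publ. RIMS **45** (2009), Def. 2.13 (i) p. 273 [cite: MochizukiEtTh2009, Def 2.13 (i) p.273 (PDF p.47)].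

PROOF-ONLY sequel (abc-iut cell, seat abc-iut-w5-d233 gen 4, self-named row «AUG-OPEN-FROM-TEMPERED»; theorems only, no
definitions) of this lineage's genuine-setting files `ThetaSettingDeltaCharacteristicGenuine` (p429527), `AbsTopMonoidsGenuineOfSetting` (p430710),
`AbsTopMonoidsGenuineOfSettingPadicClosure` (p431000), `AbsTopMonoidsGenuineOfSettingCapstone` (p433775),
`AbsTopMonoidsGenuineOfSettingIsm` (p434943), of abc-iut-L6-d2's `AbsTopMonoidsGenuineIsometriesOfSetting` (p431329) and of
abc-iut-L2-t11's `Discharge/Sec2AugOpenOfSetting` (p427479).  All of them carry the `D`-indexed binder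

  `hopen : IsOpenMap fun x : D.PiTemp => (⟨D.aug x, D.aug_mem_GK x⟩ : D.GK)`      («`Π^tp_X ↠ G_K` is an open map»),

a genuine-models-only input (it FAILS at the discrete root model, abc-iut-L2-t11 `SettingModel.not_isOpenMap_model_aug`,
p426300).  By the OPEN MAPPING THEOREM FOR TEMPERED GROUPS (abc-iut-w5-d111, `SemiGraphs/TemperedOpenMapping.lean` p416385:
`TemperedCurve.isOpenMap_augGK_of_isTempered`) this binder is a THEOREM of exactly the printed [SemiAnbd] Def. 3.1 (i) /
Ex. 3.10 properties «`Π^tp_X` tempered, Galois-countable» — the fields `isTempered` / `secondCountableTopology` of abc-iut-L3's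
§6 parameter bundle `TemperedCurve.GroupLevelData` (ruling η′: parameters, not facts).  This file records the substitution:

* `ThetaSetting.isOpenMap_augGK_mk_of_isTempered` / `…_of_groupLevelData` — `hopen` in its literal shape, from
  `IsTempered D.PiTemp` + `[FirstCountableTopology D.PiTemp]`, resp. from `d : D.toTemperedCurve.GroupLevelData`;
  NON-VACUITY: it holds outright at abc-iut-L2's χ-twisted theta setting `ThetaSetting.modelχ p`
  (`isOpenMap_augGK_mk_modelχ`);
* `ThetaSetting.quotDeltaX_iso_ofDoubleUnderline_of_isTempered` — **(H2) «`Π^tp_{X̲̲}/Δ^tp_{X̲̲} ⥲ G_K` topologically» AT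
  THE GENUINE [IUTchII] §1 SETTING `ThetaSetting.ofDoubleUnderline`** from temperedness alone (the reusable token), and
  `isOpenMap_aug_ofDoubleUnderline_of_isTempered`;
* `ThetaSetting.nonempty_absTopMonoids_ofDoubleUnderline_of_isTempered` — the [IUTchII] Ex 1.8 interface is INHABITED at
  the genuine setting modulo {tempered + Galois-countable, ONE [AbsTopI] Thm 2.6 (v) regime package};
* `AbsTopMonoids.exists_genuine_ofDoubleUnderline_of_isTempered_of_package` / `exists_genuineIsm_…` — the ∃-forms of the
  GENUINE (resp. all-fields-genuine, L6-d2's `genuineOfModelIsm`) producers at the genuine setting with NO ad-hoc topological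
  binder: residual named inputs = {η′ parameters, ONE regime package (F-0001 `CoinvariantRankConstant` + `Δ` tfg) whose
  package half is PROVED (p429527)}; the producer TERMS are `genuineOfDoubleUnderline(Ism)(Padic)_of_package …
  (D.isOpenMap_augGK_mk_of_isTempered hT) h` (p433775 / p434943), no new definition needed;
* `AbsTopMonoids.exists_allGenuine_ofDoubleUnderlinePadic_of_isTempered` — L6-d2's all-genuine ∃-form likewise;
* `ThetaSetting.EtaleThetaData.DoubleUnderline.thetaEnvData_isOpenMap_augY_of_isTempered` /
  `thetaEnvData_exists_kummer_of_isTempered` — abc-iut-L2-t11's [EtTh] Def. 2.13 (i) consumers (`kummerOut ⊆ Im(K^×)`,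
  GAP-LEDGER G-L2t11-3) with `hopenY`/`hopen` discharged the same way (D-G-L2t11-3 08:03:45Z «subsumed by η′» in the kernel).

HONEST SCOPE: kernel plumbing only (one `exact` each over landed theorems); «tempered + Galois-countable» are interface
PARAMETERS of the genuine `Π^tp_X` ([SemiAnbd] Ex. 3.10), carried by every genuine model in the tree (`modelχ`:
`isTempered_piTemp_modelχ`, `secondCountableTopology_piTemp_modelχ`) and failing at the discrete root model; the regime
package stays a FACT-LIST input BY NAME; no curve / theta setting is asserted to exist; nothing here bears on [IUTchIII]
Cor. 3.12; no side is taken; typed ≠ proved elsewhere.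
-/

noncomputable section

/-! ### §1. The `D`-indexed binder «`Π^tp_X ↠ G_K` open» from temperedness -/

namespace Literature.AnabelianGeometry.EtaleTheta

namespace ThetaSetting

open Literature.AnabelianGeometry.SemiGraphs

variable {p : ℕ} [Fact p.Prime] (D : ThetaSetting p)

/-- **«`Π^tp_X ↠ G_K` is an open map» from «`Π^tp_X` tempered with first-countable topology»**, in the literal shape of
the binder `hopen` of the genuine-setting files ([SemiAnbd] Ex. 3.10 read topologically; open mapping theorem for tempered
groups onto the compact Hausdorff `G_K = Fix(K) ≤ Gal(ℚ̄_p/ℚ_p)`). [cite: MochizukiSemiAnbd2006, Ex 3.10 p.43] -/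
theorem isOpenMap_augGK_mk_of_isTempered (hT : IsTempered D.PiTemp) [FirstCountableTopology D.PiTemp] :
    IsOpenMap fun x : D.PiTemp => (⟨D.aug x, D.aug_mem_GK x⟩ : D.GK) :=
  D.toTemperedCurve.isOpenMap_augGK_of_isTempered hT

/-- The same from abc-iut-L3's §6 parameter bundle `d : GroupLevelData` («`Π^temp` tempered, temp-slim, Galois-countable» —
ruling η′). [cite: MochizukiSemiAnbd2006, Ex 3.10 pp.43-45] -/
theorem isOpenMap_augGK_mk_of_groupLevelData (d : D.toTemperedCurve.GroupLevelData) :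
    IsOpenMap fun x : D.PiTemp => (⟨D.aug x, D.aug_mem_GK x⟩ : D.GK) := by
  haveI := d.secondCountableTopology
  exact D.isOpenMap_augGK_mk_of_isTempered d.isTempered

/-- The plain form «`D.aug : Π^tp_X → Gal(ℚ̄_p/ℚ_p)` is open» (abc-iut-L2-t11's primed consumers) from temperedness.
[cite: MochizukiSemiAnbd2006, Ex 3.10 p.43] -/
theorem isOpenMap_aug_of_isTempered' (hT : IsTempered D.PiTemp) [FirstCountableTopology D.PiTemp] :
    IsOpenMap D.aug :=
  D.toTemperedCurve.isOpenMap_aug_of_isTempered hT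

/-- **NON-VACUITY**: at abc-iut-L2's χ-twisted theta setting `ThetaSetting.modelχ p` (tempered, Galois-countable by
construction) the binder «`Π^tp_X ↠ G_K` open» HOLDS outright. [cite: MochizukiSemiAnbd2006, Ex 3.10 p.43] -/
theorem isOpenMap_augGK_mk_modelχ (p : ℕ) [Fact p.Prime] :
    IsOpenMap fun x : (ThetaSetting.modelχ p).PiTemp =>
      (⟨(ThetaSetting.modelχ p).aug x, (ThetaSetting.modelχ p).aug_mem_GK x⟩ : (ThetaSetting.modelχ p).GK) := by
  haveI := SettingModel.secondCountableTopology_piTemp_modelχ p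
  exact (ThetaSetting.modelχ p).isOpenMap_augGK_mk_of_isTempered (SettingModel.isTempered_piTemp_modelχ p)

/-- Hence the binder is SATISFIABLE over the [EtTh] §1 interface (jointly with all its axioms): some theta setting has open
`G_K`-valued augmentation. [cite: MochizukiSemiAnbd2006, Ex 3.10 p.43] -/
theorem exists_thetaSetting_isOpenMap_augGK_mk (p : ℕ) [Fact p.Prime] :
    ∃ D : ThetaSetting p, IsOpenMap fun x : D.PiTemp => (⟨D.aug x, D.aug_mem_GK x⟩ : D.GK) :=
  ⟨ThetaSetting.modelχ p, isOpenMap_augGK_mk_modelχ p⟩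

/-! ### §2. abc-iut-L2-t11's [EtTh] Def. 2.13 (i) consumers with `hopenY` discharged from temperedness -/

namespace EtaleThetaData.DoubleUnderline

variable {D} {E : D.EtaleThetaData} {l : ℕ} (C : E.DoubleUnderline l) {N : ℕ+} (μ : D.CyclotomeMod l N)
  (hC : D.Compat) (hS : D.Sec2Hyps)

/-- `hopenY` («`Π^tp_Y̲̲ ↠ G_K` open», GAP-LEDGER G-L2t11-3) from «`Π^tp_X` tempered, first countable».
[cite: MochizukiEtTh2009, Def 2.13 (i) p.273 (PDF p.47)] -/
theorem thetaEnvData_isOpenMap_augY_of_isTempered (hT : IsTempered D.PiTemp) [FirstCountableTopology D.PiTemp] :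
    IsOpenMap (C.thetaEnvData μ hC hS).augY :=
  C.thetaEnvData_isOpenMap_augY_of_isOpenMap_aug μ hC hS (D.isOpenMap_augGK_mk_of_isTempered hT)

/-- **[EtTh] Def. 2.13 (i), `kummerOut ⊆ Im(K^×)`, for tempered Galois-countable `Π^tp_X`**: abc-iut-L2-t11's
`thetaEnvData_exists_kummer_of_isOpenMap_aug` with its `D`-indexed openness hypothesis discharged.
[cite: MochizukiEtTh2009, Def 2.13 (i) p.273 (PDF p.47)] -/
theorem thetaEnvData_exists_kummer_of_isTempered (hT : IsTempered D.PiTemp) [FirstCountableTopology D.PiTemp]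
    (δ₀ : D.GK → MuN p N)
    (hδ : CycEnvelope.IsEnvCocycle (C.thetaEnvData μ hC hS).augY (C.thetaEnvData μ hC hS).chi
      (δ₀ ∘ (C.thetaEnvData μ hC hS).augY))
    (hc : CycEnvelope.shift hδ ∈ contMulAut (C.thetaEnvData μ hC hS).env) :
    ∃ (a : (D.K)ˣ) (x : (PadicAlgCl p)ˣ),
      x ^ (N : ℕ) = Units.map (algebraMap D.K (PadicAlgCl p) : D.K →* PadicAlgCl p) a ∧
        ∀ g : D.GK, ((δ₀ g : MuN p N) : (PadicAlgCl p)ˣ) = (g : GQp p) • x / x :=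
  C.thetaEnvData_exists_kummer_of_isOpenMap_aug μ hC hS (D.isOpenMap_augGK_mk_of_isTempered hT) δ₀ hδ hc

end EtaleThetaData.DoubleUnderline

end ThetaSetting

end Literature.AnabelianGeometry.EtaleTheta

/-! ### §3. (H2) and the `AbsTopMonoids` producers at the GENUINE [IUTchII] §1 setting, from temperedness -/

namespace Literature.IUT.HodgeArakelov

open Literature.AnabelianGeometry.AbsoluteAnabelian
open Literature.AnabelianGeometry.EtaleTheta Literature.AnabelianGeometry.SemiGraphs
open scoped Literature.AnabelianGeometry.EtaleTheta

section Genuine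

variable {p : ℕ} [Fact p.Prime] {D : Literature.AnabelianGeometry.EtaleTheta.ThetaSetting p}
  {ED : D.EtaleThetaData} {l : ℕ} (C : ED.DoubleUnderline l) {N : ℕ+} (μ : D.CyclotomeMod l N)
  (hC : D.Compat) (hS : D.Sec2Hyps) (hl : l.Prime) (hp2 : p ≠ 2) (hpl : p ≠ l)
  (hζ : ∃ ζ : D.K, IsPrimitiveRoot ζ (4 * l)) {η : (C.thetaEnvData μ hC hS).PiYdd → MuN p N}
  (hη : η ∈ (C.thetaEnvData μ hC hS).thetaCocycles)

/-- The augmentation `Π^tp_{X̲̲} ↠ G_K` of the genuine setting `ofDoubleUnderline` is OPEN for tempered Galois-countable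
`Π^tp_X` (restriction of the open `Π^tp_X ↠ G_K` to the open subgroup `Π^tp_{X̲̲}`).
[cite: MochizukiSemiAnbd2006, Ex 3.10 p.43] -/
theorem ThetaSetting.isOpenMap_aug_ofDoubleUnderline_of_isTempered (hT : IsTempered D.PiTemp)
    [FirstCountableTopology D.PiTemp] :
    IsOpenMap (ThetaSetting.ofDoubleUnderline C μ hC hS hl hp2 hpl hζ hη).aug :=
  ThetaSetting.isOpenMap_aug_ofDoubleUnderline C μ hC hS hl hp2 hpl hζ hη (D.isOpenMap_augGK_mk_of_isTempered hT)

/-- **(H2) AT THE GENUINE SETTING from temperedness**: `Π^tp_{X̲̲}/Δ^tp_{X̲̲} ⥲ G_K` as TOPOLOGICAL groups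
([IUTchII] Ex 1.8 (i), kurims p. 35 l. 45–47, prints the display «α : Π/Δ ⥲ G»; «the quotient `Π ↠ G_k`» is OUR gloss of
it, not print's words), for tempered Galois-countable `Π^tp_X` — abc-iut-w5-d105's topological
first isomorphism theorem `quotDeltaX_iso_of_isOpenMap` over the open augmentation.
[claim: Mochizuki2012, status: disputed] (IUTchII §1 Ex 1.8 (i), kurims p.35) [cite: MochizukiSemiAnbd2006, Ex 3.10 p.43] -/
theorem ThetaSetting.quotDeltaX_iso_ofDoubleUnderline_of_isTempered (hT : IsTempered D.PiTemp)
    [FirstCountableTopology D.PiTemp] :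
    Nonempty (TopGroup.quot (ThetaSetting.ofDoubleUnderline C μ hC hS hl hp2 hpl hζ hη).PiX
        (ThetaSetting.ofDoubleUnderline C μ hC hS hl hp2 hpl hζ hη).DeltaX ≃ₜ*
      (ThetaSetting.ofDoubleUnderline C μ hC hS hl hp2 hpl hζ hη).Gk) :=
  AbsTopMonoids.quotDeltaX_iso_of_isOpenMap _
    (ThetaSetting.isOpenMap_aug_ofDoubleUnderline_of_isTempered C μ hC hS hl hp2 hpl hζ hη hT)

/-- (H2) at the genuine setting from the §6 parameter bundle `d : GroupLevelData`.
[claim: Mochizuki2012, status: disputed] (IUTchII §1 Ex 1.8 (i), kurims p.35) -/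
theorem ThetaSetting.quotDeltaX_iso_ofDoubleUnderline_of_groupLevelData (d : D.toTemperedCurve.GroupLevelData) :
    Nonempty (TopGroup.quot (ThetaSetting.ofDoubleUnderline C μ hC hS hl hp2 hpl hζ hη).PiX
        (ThetaSetting.ofDoubleUnderline C μ hC hS hl hp2 hpl hζ hη).DeltaX ≃ₜ*
      (ThetaSetting.ofDoubleUnderline C μ hC hS hl hp2 hpl hζ hη).Gk) := by
  haveI := d.secondCountableTopology
  exact ThetaSetting.quotDeltaX_iso_ofDoubleUnderline_of_isTempered C μ hC hS hl hp2 hpl hζ hη d.isTempered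

/-- **The [IUTchII] Ex 1.8 interface `AbsTopMonoids` IS INHABITED AT THE GENUINE SETTING modulo {«`Π^tp_X` tempered,
Galois-countable», ONE compatible MLF completion package in the [AbsTopI] Thm 2.6 (v) regime}** — this lineage's
`nonempty_absTopMonoids_ofDoubleUnderline` (p429527) with «aug open» discharged.
[claim: Mochizuki2012, status: disputed] (IUTchII §1 Ex 1.8 (i), kurims p.35) -/
theorem ThetaSetting.nonempty_absTopMonoids_ofDoubleUnderline_of_isTempered (hT : IsTempered D.PiTemp)
    [FirstCountableTopology D.PiTemp]
    (h : ∃ (E : FundamentalExtension.{0}) (_ : E.MLFBase)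
      (ι : (ThetaSetting.ofDoubleUnderline C μ hC hS hl hp2 hpl hζ hη).PiX →ₜ* E.arith)
      (g : (ThetaSetting.ofDoubleUnderline C μ hC hS hl hp2 hpl hζ hη).Gk →* E.gal),
      IsProfiniteCompletion ι ∧ Function.Injective g ∧
        (∀ x, E.aug (ι x) = g ((ThetaSetting.ofDoubleUnderline C μ hC hS hl hp2 hpl hζ hη).aug x)) ∧
        IsTopologicallyFinitelyGenerated E.geom ∧ E.CoinvariantRankConstant) :
    Nonempty (AbsTopMonoids (ThetaSetting.ofDoubleUnderline C μ hC hS hl hp2 hpl hζ hη)) :=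
  ThetaSetting.nonempty_absTopMonoids_ofDoubleUnderline C μ hC hS hl hp2 hpl hζ hη
    (D.isOpenMap_augGK_mk_of_isTempered hT) h

namespace AbsTopMonoids

/-- **∃-form (monoid genuine)**: for tempered Galois-countable `Π^tp_X` and ONE regime package, `AbsTopMonoids` is inhabited at
the genuine setting by a producer whose monoid at every isomorph of `G_K` IS `𝒪^⊳_{K̄_K}` of THE SETTING'S FIELD.
[claim: Mochizuki2012, status: disputed] (IUTchII §1 Ex 1.8 (ii), kurims p.36) -/
theorem exists_genuine_ofDoubleUnderline_of_isTempered_of_package (hT : IsTempered D.PiTemp)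
    [FirstCountableTopology D.PiTemp]
    (h : ∃ (E : FundamentalExtension.{0}) (_ : E.MLFBase)
      (ι : (ThetaSetting.ofDoubleUnderline C μ hC hS hl hp2 hpl hζ hη).PiX →ₜ* E.arith)
      (g : (ThetaSetting.ofDoubleUnderline C μ hC hS hl hp2 hpl hζ hη).Gk →* E.gal),
      IsProfiniteCompletion ι ∧ Function.Injective g ∧
        (∀ x, E.aug (ι x) = g ((ThetaSetting.ofDoubleUnderline C μ hC hS hl hp2 hpl hζ hη).aug x)) ∧
        IsTopologicallyFinitelyGenerated E.geom ∧ E.CoinvariantRankConstant) :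
    ∃ A : AbsTopMonoids (ThetaSetting.ofDoubleUnderline C μ hC hS hl hp2 hpl hζ hη),
      ∀ G, A.Otri G =
        (ModelMLFGaloisData.galois D.toTemperedCurve.mlfClosure.k D.toTemperedCurve.mlfClosure.K).tmPair.M :=
  exists_genuine_ofDoubleUnderline_of_package C μ hC hS hl hp2 hpl hζ hη (D.isOpenMap_augGK_mk_of_isTempered hT) h

/-- **∃-form, ALL FIELDS GENUINE** (monoid `𝒪^⊳_{K̄_K}` and `Ism(G)` = print's isometry group of the genuine-mod-`ε`
producer), for tempered Galois-countable `Π^tp_X` and ONE regime package.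
[claim: Mochizuki2012, status: disputed] (IUTchII §1 Ex 1.8 (iv), kurims p.39) -/
theorem exists_genuineIsm_ofDoubleUnderline_of_isTempered_of_package (hT : IsTempered D.PiTemp)
    [FirstCountableTopology D.PiTemp]
    (h : ∃ (E : FundamentalExtension.{0}) (_ : E.MLFBase)
      (ι : (ThetaSetting.ofDoubleUnderline C μ hC hS hl hp2 hpl hζ hη).PiX →ₜ* E.arith)
      (g : (ThetaSetting.ofDoubleUnderline C μ hC hS hl hp2 hpl hζ hη).Gk →* E.gal),
      IsProfiniteCompletion ι ∧ Function.Injective g ∧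
        (∀ x, E.aug (ι x) = g ((ThetaSetting.ofDoubleUnderline C μ hC hS hl hp2 hpl hζ hη).aug x)) ∧
        IsTopologicallyFinitelyGenerated E.geom ∧ E.CoinvariantRankConstant) :
    ∃ A : AbsTopMonoids (ThetaSetting.ofDoubleUnderline C μ hC hS hl hp2 hpl hζ hη),
      (∀ G, A.Otri G =
        (ModelMLFGaloisData.galois D.toTemperedCurve.mlfClosure.k D.toTemperedCurve.mlfClosure.K).tmPair.M) ∧
      ∀ G, A.Ism G = ↥((genuineOfModel (ThetaSetting.ofDoubleUnderline C μ hC hS hl hp2 hpl hζ hη)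
          D.toTemperedCurve.mlfClosure D.toTemperedCurve.galoisEpsilon
          (ThetaSetting.deltaX_characteristic_ofDoubleUnderline_of_exists_package C μ hC hS hl hp2 hpl hζ hη h)
          (ThetaSetting.quotDeltaX_iso_ofDoubleUnderline_of_isTempered C μ hC hS hl hp2 hpl hζ hη hT)).ism G) :=
  exists_genuineIsm_ofDoubleUnderline_of_package C μ hC hS hl hp2 hpl hζ hη (D.isOpenMap_augGK_mk_of_isTempered hT) h

/-- **L6-d2's ALL-GENUINE ∃-form over `(K, ℚ̄_p, ε = id)`** (`exists_allGenuine_ofDoubleUnderlinePadic_of_isOpenMap`,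
p431329) for tempered Galois-countable `Π^tp_X`: only (H1) `hΔ` is left as a hypothesis.
[claim: Mochizuki2012, status: disputed] (IUTchII §1 Ex 1.8 (iv), kurims p.39) -/
theorem exists_allGenuine_ofDoubleUnderlinePadic_of_isTempered (hT : IsTempered D.PiTemp)
    [FirstCountableTopology D.PiTemp]
    (hΔ : ∀ f : (ThetaSetting.ofDoubleUnderline C μ hC hS hl hp2 hpl hζ hη).PiX ≃ₜ*
        (ThetaSetting.ofDoubleUnderline C μ hC hS hl hp2 hpl hζ hη).PiX,
      (ThetaSetting.ofDoubleUnderline C μ hC hS hl hp2 hpl hζ hη).DeltaX.map f.toMulEquiv.toMonoidHom =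
        (ThetaSetting.ofDoubleUnderline C μ hC hS hl hp2 hpl hζ hη).DeltaX) :
    ∃ A : AbsTopMonoids (ThetaSetting.ofDoubleUnderline C μ hC hS hl hp2 hpl hζ hη),
      (∀ G, A.Otri G =
        (ModelMLFGaloisData.galois D.toTemperedCurve.mlfClosurePadic.k D.toTemperedCurve.mlfClosurePadic.K).tmPair.M) ∧
      (∀ G, A.Ism G = ↥(A.ism G)) ∧
      (∀ (G : IsoClass (ThetaSetting.ofDoubleUnderline C μ hC hS hl hp2 hpl hζ hη).Gk) (x : A.Oxmu G),
        A.actIsm G (A.toIsm G ZHatLevel.negOneAut) x = x⁻¹) ∧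
      Rmk1111_d A :=
  exists_allGenuine_ofDoubleUnderlinePadic_of_isOpenMap C μ hC hS hl hp2 hpl hζ hη
    (D.isOpenMap_augGK_mk_of_isTempered hT) hΔ

end AbsTopMonoids

end Genuine

end Literature.IUT.HodgeArakelov

end
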